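import Summits.ABC.ABC.Theses.CubicResolventAllowance
import HarnessLib

/-!
# Stub-ideation k=2 (RESHAPE), GEN 7 — `stub_realCubic` of crux `IndexSzpiro` (stmt-ABC-22740)

Companion of `STUB-IDEAS-stub_realCubic-2.md` (gen 7).  Gens 2–6 of this slot stay valid and are NOT repeated
(`StubIdeas2Sketch.lean` dictionary / CORE A; `StubIdeas2RealG3–G6Sketch.lean`: frame normalisation, exceptional-set
rung, Roth–Ridout floor + ladder + prime-power rung, quantifier surgery U1, small/large split H1–H5).
Gen 7 types the two RESHAPE moves that were still missing on this page:

* §J  **T-α — the cut is archimedean.**  `0 < d_K ⟺ 0 < Δ(W) ⟺ j(W) > 1728` (or `j = 1728, c₄ > 0`): the sign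
  hypothesis of the stub is the position of `j` at the INFINITE place, while the Szpiro content of the stub is the
  polar divisor of `j` at the FINITE places (`n_p = -v_p(j)` at a multiplicative prime).  Typed: J1–J3, R1.
* §S  **T-β — regime split by `Gal(ψ₂)` and the parity of the resolvent Artin representation.**  `C₃`-door
  `d_K ∈ ℤ² ⟺ Δ(W) ∈ ℚ²` (S2) and its consequence "all towers even" (S3); the `.md` carries the automorphic
  reading (real cubic ⟹ EVEN `S₃`-representation ⟹ Maass avatar, Bump §1.9) — no Lean (no Artin conductors in Mathlib).

All six helpers (R1, J1, J2, J3, S2, S3) are PROVED (no `sorry`); they are S-sized and land as ONE section file.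
-/

noncomputable section

open Polynomial NumberField WeierstrassCurve

namespace Summit.ABC.ABC.Cruxes.IndexSzpiro.StubIdeas2RealG7

/-! ## §0 The two registered stubs, verbatim (skeleton `line2-birth.lean`, sha d34fb8f2…) -/

/-- `stub_realCubic`, verbatim. -/
def StubRealCubic : Prop :=
  ∀ ε : ℝ, 0 < ε → ∃ C : ℝ, ∀ (W : WeierstrassCurve ℚ) [W.IsElliptic] (K : Type) [Field K] [NumberField K],
    Irreducible W.twoTorsionPolynomial.toPoly → Module.finrank ℚ K = 3 →
    (∃ θ : K, aeval θ W.twoTorsionPolynomial.toPoly = 0) → 0 < NumberField.discr K →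
    (W.minimalDiscriminantNorm ℤ : ℝ) ≤ C * |(NumberField.discr K : ℝ)| * (W.conductorNorm ℤ : ℝ) ^ (6 + ε)

/-- `stub_complexCubic`, verbatim. -/
def StubComplexCubic : Prop :=
  ∀ ε : ℝ, 0 < ε → ∃ C : ℝ, ∀ (W : WeierstrassCurve ℚ) [W.IsElliptic] (K : Type) [Field K] [NumberField K],
    Irreducible W.twoTorsionPolynomial.toPoly → Module.finrank ℚ K = 3 →
    (∃ θ : K, aeval θ W.twoTorsionPolynomial.toPoly = 0) → NumberField.discr K < 0 →
    (W.minimalDiscriminantNorm ℤ : ℝ) ≤ C * |(NumberField.discr K : ℝ)| * (W.conductorNorm ℤ : ℝ) ^ (6 + ε)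

/-! ## §R  The sign split is free: the two stubs are EXACTLY the crux (no slack either way) -/

/-- **R1 (S, PROVED).** `IndexSzpiro ↔ stub_realCubic ∧ stub_complexCubic` (`d_K ≠ 0`, Mathlib
`NumberField.discr_ne_zero`; the `→` directions are restrictions, `←` takes `C = max C₊ C₋`).  Reading: the registered
composition `IndexSzpiro_of` loses nothing and adds nothing — any proof of one half that does not use the infinite
place proves the other half verbatim. [folklore] -/
theorem indexSzpiro_iff :
    Summit.ABC.ABC.Theses.CubicResolventAllowance.IndexSzpiro ↔ StubRealCubic ∧ StubComplexCubic := by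
  constructor
  · intro h
    refine ⟨fun ε hε => ?_, fun ε hε => ?_⟩
    · obtain ⟨C, hC⟩ := h ε hε
      exact ⟨C, fun W _ K _ _ hirr hdeg hθ _ => hC W K hirr hdeg hθ⟩
    · obtain ⟨C, hC⟩ := h ε hε
      exact ⟨C, fun W _ K _ _ hirr hdeg hθ _ => hC W K hirr hdeg hθ⟩
  · rintro ⟨hpos, hneg⟩ ε hε
    obtain ⟨C₁, h₁⟩ := hpos ε hε
    obtain ⟨C₂, h₂⟩ := hneg ε hε
    refine ⟨max C₁ C₂, fun W _ K _ _ hirr hdeg hθ => ?_⟩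
    have hnn : (0 : ℝ) ≤ |(NumberField.discr K : ℝ)| * (W.conductorNorm ℤ : ℝ) ^ (6 + ε) := by positivity
    rcases lt_or_gt_of_ne (NumberField.discr_ne_zero K) with hlt | hgt
    · calc (W.minimalDiscriminantNorm ℤ : ℝ) ≤ C₂ * |(NumberField.discr K : ℝ)| * (W.conductorNorm ℤ : ℝ) ^ (6 + ε) :=
            h₂ W K hirr hdeg hθ hlt
        _ = C₂ * (|(NumberField.discr K : ℝ)| * (W.conductorNorm ℤ : ℝ) ^ (6 + ε)) := by ring
        _ ≤ max C₁ C₂ * (|(NumberField.discr K : ℝ)| * (W.conductorNorm ℤ : ℝ) ^ (6 + ε)) :=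
            mul_le_mul_of_nonneg_right (le_max_right _ _) hnn
        _ = max C₁ C₂ * |(NumberField.discr K : ℝ)| * (W.conductorNorm ℤ : ℝ) ^ (6 + ε) := by ring
    · calc (W.minimalDiscriminantNorm ℤ : ℝ) ≤ C₁ * |(NumberField.discr K : ℝ)| * (W.conductorNorm ℤ : ℝ) ^ (6 + ε) :=
            h₁ W K hirr hdeg hθ hgt
        _ = C₁ * (|(NumberField.discr K : ℝ)| * (W.conductorNorm ℤ : ℝ) ^ (6 + ε)) := by ring
        _ ≤ max C₁ C₂ * (|(NumberField.discr K : ℝ)| * (W.conductorNorm ℤ : ℝ) ^ (6 + ε)) :=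
            mul_le_mul_of_nonneg_right (le_max_left _ _) hnn
        _ = max C₁ C₂ * |(NumberField.discr K : ℝ)| * (W.conductorNorm ℤ : ℝ) ^ (6 + ε) := by ring

/-! ## §J  T-α: the sign is the archimedean position of `j`; the content is the finite polar divisor of `j` -/

/-- **J1 (S).** For an elliptic curve over `ℚ` (any model): `0 < Δ ⟺ 1728 < j`, except on the fibre `c₆ = 0`
(`j = 1728`) where `0 < Δ ⟺ 0 < c₄`.  Proof: `1728·Δ = c₄³ − c₆²` (Mathlib `WeierstrassCurve.c_relation`) and
`j = c₄³/Δ`, so `j − 1728 = c₆²/Δ`.  [cite: Silverman1994, Cor. V.2.3.1 and Ex. 5.6 (Δ > 0 ⟺ E ≅ E⟨it⟩, rectangular lattice)] -/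
theorem Δ_pos_iff_j (W : WeierstrassCurve ℚ) [W.IsElliptic] :
    0 < W.Δ ↔ 1728 < W.j ∨ (W.c₆ = 0 ∧ 0 < W.c₄) := by
  have hΔ : W.Δ ≠ 0 := W.isUnit_Δ.ne_zero
  have hj : W.j = W.c₄ ^ 3 / W.Δ := by
    rw [WeierstrassCurve.j, Units.val_inv_eq_inv_val, WeierstrassCurve.coe_Δ', div_eq_inv_mul]
  have hrel : W.c₄ ^ 3 = 1728 * W.Δ + W.c₆ ^ 2 := by
    have := W.c_relation; linarith
  have hj' : W.j - 1728 = W.c₆ ^ 2 / W.Δ := by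
    rw [hj, hrel]; field_simp; ring
  by_cases hc6 : W.c₆ = 0
  · have hj1728 : W.j = 1728 := by
      have : W.j - 1728 = 0 := by rw [hj', hc6]; simp
      linarith
    have hc4cube : W.c₄ ^ 3 = 1728 * W.Δ := by rw [hrel, hc6]; ring
    constructor
    · intro hpos
      refine Or.inr ⟨hc6, ?_⟩
      have h3 : 0 < W.c₄ ^ 3 := by rw [hc4cube]; positivity
      exact (Odd.pow_pos_iff (by decide : Odd 3)).mp h3
    · rintro (h | ⟨-, h⟩)
      · rw [hj1728] at h; exact absurd h (lt_irrefl _)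
      · have h3 : 0 < W.c₄ ^ 3 := pow_pos h 3
        rw [hc4cube] at h3; linarith
  · have hc6sq : 0 < W.c₆ ^ 2 := by positivity
    constructor
    · intro hpos
      left
      have : 0 < W.j - 1728 := by rw [hj']; positivity
      linarith
    · rintro (h | ⟨h, -⟩)
      · have h1 : 0 < W.c₆ ^ 2 / W.Δ := by rw [← hj']; linarith
        rcases lt_or_gt_of_ne hΔ with hlt | hgt
        · exact absurd h1 (not_lt.mpr (div_neg_of_pos_of_neg hc6sq hlt).le)
        · exact hgt
      · exact absurd h hc6

/-- **J2 (S).** On the stub's class the sign hypothesis `0 < d_K` IS `j > 1728` (or `j = 1728 ∧ c₄ > 0`): from J1 and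
the keystone `Δ(W) = q²·d_K` (PROVED as `K6_Δ_eq_sq_mul_discr` in `Cruxes/IndexSzpiro/StubIdeas1G5Sketch.lean`; taken
here as the hypothesis `hkey` because crux sketches are not importable).  So `stub_realCubic = IndexSzpiro|{j ≥ 1728}`,
`stub_complexCubic = IndexSzpiro|{j < 1728}`. [folklore] -/
theorem realClass_iff_j (W : WeierstrassCurve ℚ) [W.IsElliptic] (K : Type) [Field K] [NumberField K]
    (hkey : ∃ q : ℚ, q ≠ 0 ∧ W.Δ = q ^ 2 * (NumberField.discr K : ℚ)) :
    0 < NumberField.discr K ↔ 1728 < W.j ∨ (W.c₆ = 0 ∧ 0 < W.c₄) := by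
  obtain ⟨q, hq0, hq⟩ := hkey
  have hq2 : (0 : ℚ) < q ^ 2 := by positivity
  rw [← Δ_pos_iff_j W, hq, mul_pos_iff_of_pos_left hq2]
  exact_mod_cast Iff.rfl

/-- **J3 (S).** `v_p(j) = −v_p(Δ)` whenever `v_p(c₄) = 0` (`c₄ ≠ 0`).  For the `p`-minimal model at a multiplicative
prime `p ≥ 5` this is `n_p = v_p(Δ_min) = −v_p(j)`: the towers the stub must bound are the finite poles of `j`,
a datum blind to the sign of `Δ`, i.e. (J1) to the side of `1728` on which `j` sits at the infinite place.
[cite: SilvermanAEC2009, VII.5.1(b) (multiplicative ⟺ v(c₄) = 0 < v(Δ) for a minimal model)] -/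
theorem padicValRat_j_of_c₄ (W : WeierstrassCurve ℚ) [W.IsElliptic] (p : ℕ) [Fact p.Prime]
    (hc4 : W.c₄ ≠ 0) (hv : padicValRat p W.c₄ = 0) :
    padicValRat p W.j = -padicValRat p W.Δ := by
  have hΔ : W.Δ ≠ 0 := W.isUnit_Δ.ne_zero
  have hj : W.j = W.c₄ ^ 3 / W.Δ := by
    rw [WeierstrassCurve.j, Units.val_inv_eq_inv_val, WeierstrassCurve.coe_Δ', div_eq_inv_mul]
  rw [hj, padicValRat.div (pow_ne_zero 3 hc4) hΔ, padicValRat.pow W.c₄, hv]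
  simp

/-! ## §S  T-β: regime split by `Gal(ψ₂)` — the `C₃` door and "all towers even" -/

/-- **S2 (S, PROVED).** `C₃`-door: on the class, `d_K` is a square ⟺ `Δ(W)` is a square in `ℚ` (keystone `Δ = q²·d_K`; an
integer that is a rational square is an integer square).  Classically `d_K ∈ ℤ² ⟺ K/ℚ` Galois (cyclic) `⟺ Gal(ψ₂) = C₃`
(not in Mathlib; not needed below). [folklore] -/
theorem discr_isSquare_iff (W : WeierstrassCurve ℚ) [W.IsElliptic] (K : Type) [Field K] [NumberField K]
    (hkey : ∃ q : ℚ, q ≠ 0 ∧ W.Δ = q ^ 2 * (NumberField.discr K : ℚ)) :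
    IsSquare (NumberField.discr K) ↔ IsSquare W.Δ := by
  obtain ⟨q, hq, hΔ⟩ := hkey
  rw [← Rat.isSquare_intCast_iff, hΔ]
  constructor
  · rintro ⟨r, hr⟩
    exact ⟨q * r, by rw [hr]; ring⟩
  · rintro ⟨s, hs⟩
    refine ⟨s / q, ?_⟩
    have h1 : (NumberField.discr K : ℚ) = s * s / q ^ 2 := by
      rw [← hs, eq_div_iff (pow_ne_zero 2 hq)]; ring
    rw [h1]; ring

/-- **S3 (S, PROVED).** In the `C₃` regime every finite valuation of `Δ(W)` — hence of `Δ_min = u⁻¹²Δ(W)`, hence every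
multiplicative tower `n_p` — is EVEN; with the parity law (`p ≥ 5`, `p ∥ N`: `p ∣ d_K ⟺ n_p` odd; typed k1-G4 `S1`,
k2-G5 §A, census j344917: 0 violations on 638 834 curves) the allowance `|d_K|` is then supported on `3` and the additive
primes only: the `C₃` window of the stub is Szpiro `6+ε` with allowance `≤ 3⁵·∏_{p²∣N} p²` on square-discriminant curves
without rational 2-torsion — the sub-window with the least slack. [folklore] -/
theorem even_padicValRat_Δ_of_isSquare (W : WeierstrassCurve ℚ) [W.IsElliptic] (hsq : IsSquare W.Δ)
    (p : ℕ) [Fact p.Prime] : Even (padicValRat p W.Δ) := by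
  obtain ⟨r, hr⟩ := hsq
  have hr0 : r ≠ 0 := by
    rintro rfl
    exact W.isUnit_Δ.ne_zero (by simpa using hr)
  rw [hr, padicValRat.mul hr0 hr0]
  exact ⟨_, rfl⟩

end Summit.ABC.ABC.Cruxes.IndexSzpiro.StubIdeas2RealG7

end
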